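import Mathlib
import HarnessLib.Audit
import Summits.PneNP.PneNP.Theorems.PstarChordBridgeAssemble
import Summits.PneNP.PneNP.Theorems.PstarUnionRankSixEmpty
import Summits.PneNP.PneNP.Theorems.PstarUnion

/-!
# Bridge data for a union-terminal core: the instance-level wrapper of Case A's kernel node (ROUND-24, memo §14.16–§14.20; p3 g22 ORDER (i))

FRONTIER range-avoidance ladder, rung F-N3, ROUND 24 (cell `pnp-ideate`, planner memo `r24/CORE-BOUND-NOTES.md` §14.16–§14.20, planner p3 g22 STATUS 20:09:33Z ORDER (i);
restricted-model proof complexity — nothing here bears on `P` versus `NP`).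

`PstarChordBridgeAssemble.exists_bridgeData` packages a TERMINAL core ((T3) + (M0) for ONE pair) as bridge data.  In the union setting (M0) holds only as the
UNION COVER; but the join construction (`PstarChordBridgeJoin.closed_even`) uses (M0) only to get ONE assignment satisfying both constraints (outputs ignored).
This file re-runs the packaging under that weaker hypothesis and wraps `PstarUnionRankSixEmpty.caseA_empty_of_kernel_trivial` at the instance level:

* `closed_even_of_sat`, `exists_join_of_sat`, `exists_bridgeData_of_sat` — the packaging with (M0) replaced by `∃ z, Γ₁(z) ∧ Γ₂(z)`;
* `exists_union_bridgeData` — **a union-terminal core (`PstarUnion.UnionTerminal`) with a maximal peelable `F`, chords `J₀ ∖ F` and hun IS the configuration of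
  `caseA_empty_of_kernel_trivial`**: bridge data `B` for the pair `(R, w₂)` and second reader `R′`, `{R, R′} = {A₀, A₁}` (`R` = a reader released by some output),
  with `B.WF`, `Lift`, the XOR-agreement of `R′`, (T3) twice and the cover (M0′) in `Solution` form;
* `caseA_false_of_kernel_trivial` — **node (α) at the instance level**: the `CaseAFive` hypotheses (`PstarUnionAtoms.CaseAFive`: union-terminal, admissible `F`, hun,
  `w₂` chord-blind) together with «for every join `T₂ ⊆ F` of the XOR reads of `w₂`, `q_{T₂} := free₂ + b₂` has a zero and trivial kernel» are contradictory.
  (The join of a forest is unique, so the quantifier over `T₂` names the one function `q = w₂|V₀ + t₂` without choosing data.)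
-/

set_option linter.dupNamespace false -- `Summit.PneNP.PneNP.…`: summit = sub-problem name (D-0017 single-conjunct layout)

open Finset Literature.Computability.Complexity
open scoped symmDiff
open Summit.PneNP.PneNP.Theorems.PstarFibrePolys (bit bit_injective)
open Summit.PneNP.PneNP.Theorems.PstarTyped (Typed)
open Summit.PneNP.PneNP.Theorems.PstarSALevel (varSet bdry BoundaryExpanding SimpleOverlap)
open Summit.PneNP.PneNP.Theorems.PstarGapOneAll (gval)
open Summit.PneNP.PneNP.Theorems.PstarXorElimination (pdeg)
open Summit.PneNP.PneNP.Theorems.PstarXCore (xpair xverts mem_xpair)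
open Summit.PneNP.PneNP.Theorems.PstarCubeIdeals (IsQuadFn)
open Summit.PneNP.PneNP.Theorems.PstarChordRepair (IsChord)
open Summit.PneNP.PneNP.Theorems.PstarGapPeeling (feasible_of_boundaryExpanding)
open Summit.PneNP.PneNP.Theorems.PstarGSystemFreeVar (gval_symmDiff)
open Summit.PneNP.PneNP.Theorems.PstarChordBridgeTools
open Summit.PneNP.PneNP.Theorems.PstarChordBridge
open Summit.PneNP.PneNP.Theorems.PstarChordBridgeLift (lift_of_wf_peelable)
open Summit.PneNP.PneNP.Theorems.PstarChordBridgeTerminal (HasConstraints)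
open Summit.PneNP.PneNP.Theorems.PstarChordBridgeCotree (Peelable exists_fundamental_of_maximal)
open Summit.PneNP.PneNP.Theorems.PstarChordBridgeJoin (flipSet eval_flipSet_iff gval_flipSet_iff false_of_unsat exists_join closed_of_chain)
open Summit.PneNP.PneNP.Theorems.PstarChordBridgeAssemble (reflTransGen_mono ends_connected_of_even)
open Summit.PneNP.PneNP.Theorems.PstarChordBridgeTools (privs)
open Summit.PneNP.PneNP.Theorems.PstarUnion (SatPair UnionTerminal)
open Summit.PneNP.PneNP.Theorems.PstarUnionRankSixEmpty (caseA_empty_of_kernel_trivial)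

namespace Summit.PneNP.PneNP.Theorems.PstarUnionBridgeData

variable {n m : ℕ}

/-! ## Joins from one satisfying assignment -/

/-- **R6 with (M0) weakened to one satisfying assignment.**  Core `J₀` with `#J₀ ≤ r`, two G-constraints with monomials disjoint from `J₀`, (T3), and SOME assignment
satisfying both constraints (outputs ignored); `U` avoids all AND slots and is closed under `J₀`.  Then `#(C₁ ∩ U)` and `#(C₂ ∩ U)` are even.
(The proof of `PstarChordBridgeJoin.closed_even`, which uses (M0) for nothing else.) -/
theorem closed_even_of_sat (I : LocalMap 4 n m) (hI : I.IsPure xorAndPred) (hT : Typed I) (hS : SimpleOverlap I) {r : ℕ} (hB : BoundaryExpanding r I)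
    (y : Fin m → Bool) {J₀ : Finset (Fin m)} (hr : J₀.card ≤ r)
    {C₁ C₂ : Finset (Fin n)} {G₁ G₂ : Finset (Fin m)} {b₁ b₂ : Bool} (hG₁ : Disjoint J₀ G₁) (hG₂ : Disjoint J₀ G₂)
    (hT3 : ¬ ∃ z : Fin n → Bool, (∀ j ∈ J₀, I.eval z j = y j) ∧ gval I C₁ G₁ z = b₁ ∧ gval I C₂ G₂ z = b₂)
    (hsat : ∃ z : Fin n → Bool, gval I C₁ G₁ z = b₁ ∧ gval I C₂ G₂ z = b₂)
    {U : Finset (Fin n)} (hU : ∀ (j : Fin m) (s : Fin 4), 2 ≤ s.val → I.vars j s ∉ U)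
    (hclosed : ∀ j ∈ J₀, (I.vars j 0 ∈ U ↔ I.vars j 1 ∈ U)) :
    Even (C₁.filter fun v => v ∈ U).card ∧ Even (C₂.filter fun v => v ∈ U).card := by
  classical
  obtain ⟨z₀, hz₁, hz₂⟩ := hsat
  have hUG : ∀ G : Finset (Fin m), ∀ g ∈ G, I.vars g 2 ∉ U ∧ I.vars g 3 ∉ U := fun G g _ => ⟨hU g 2 (by decide), hU g 3 (by decide)⟩
  have hflipJ : ∀ z : Fin n → Bool, (∀ j ∈ J₀, I.eval z j = y j) → ∀ j ∈ J₀, I.eval (flipSet U z) j = y j :=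
    fun z hz j hj => by rw [(eval_flipSet_iff I hI hU z j).2 (hclosed j hj)]; exact hz j hj
  have bflip : ∀ a b c : Bool, a ≠ b → c ≠ a → c = b := by decide
  have hkeep : ∀ (C : Finset (Fin n)) (G : Finset (Fin m)) (z : Fin n → Bool), Even (C.filter fun v => v ∈ U).card →
      gval I C G (flipSet U z) = gval I C G z := fun C G z h => (gval_flipSet_iff I C (hUG G) z).2 h
  have hmove : ∀ (C : Finset (Fin n)) (G : Finset (Fin m)) (z : Fin n → Bool), ¬ Even (C.filter fun v => v ∈ U).card →
      gval I C G (flipSet U z) ≠ gval I C G z := fun C G z h he => h ((gval_flipSet_iff I C (hUG G) z).1 he)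
  by_contra hnot
  by_cases h₁ : Even (C₁.filter fun v => v ∈ U).card <;> by_cases h₂ : Even (C₂.filter fun v => v ∈ U).card
  · exact hnot ⟨h₁, h₂⟩
  · refine false_of_unsat I hI hT hS hB y hr hG₁ (fun z hz hb₁ => ?_) hz₁
    by_cases hb₂ : gval I C₂ G₂ z = b₂
    · exact hT3 ⟨z, hz, hb₁, hb₂⟩
    · exact hT3 ⟨flipSet U z, hflipJ z hz, by rw [hkeep C₁ G₁ z h₁, hb₁], bflip _ _ _ hb₂ (hmove C₂ G₂ z h₂)⟩
  · refine false_of_unsat I hI hT hS hB y hr hG₂ (fun z hz hb₂ => ?_) hz₂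
    by_cases hb₁ : gval I C₁ G₁ z = b₁
    · exact hT3 ⟨z, hz, hb₁, hb₂⟩
    · exact hT3 ⟨flipSet U z, hflipJ z hz, bflip _ _ _ hb₁ (hmove C₁ G₁ z h₁), by rw [hkeep C₂ G₂ z h₂, hb₂]⟩
  · have hG : Disjoint J₀ (G₁ ∆ G₂) := by
      rw [disjoint_left]
      intro g hg hg'
      rw [mem_symmDiff] at hg'
      rcases hg' with ⟨h, -⟩ | ⟨h, -⟩
      · exact disjoint_left.1 hG₁ hg h
      · exact disjoint_left.1 hG₂ hg h
    refine false_of_unsat I hI hT hS hB y hr hG (C := C₁ ∆ C₂) (b := xor b₁ b₂) (fun z hz hb => ?_)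
      (by rw [gval_symmDiff, hz₁, hz₂])
    rw [gval_symmDiff] at hb
    by_cases hb₁ : gval I C₁ G₁ z = b₁
    · rw [hb₁] at hb
      have hb₂ : gval I C₂ G₂ z = b₂ := by revert hb; cases b₁ <;> cases b₂ <;> cases gval I C₂ G₂ z <;> decide
      exact hT3 ⟨z, hz, hb₁, hb₂⟩
    · have hb₂ : gval I C₂ G₂ z ≠ b₂ := by
        intro hb₂; rw [hb₂] at hb; apply hb₁; revert hb; cases b₁ <;> cases b₂ <;> cases gval I C₁ G₁ z <;> decide
      exact hT3 ⟨flipSet U z, hflipJ z hz, bflip _ _ _ hb₁ (hmove C₁ G₁ z h₁), bflip _ _ _ hb₂ (hmove C₂ G₂ z h₂)⟩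

/-- **Joins exist from one satisfying assignment** (`PstarChordBridgeJoin.exists_join_of_terminal` with (M0) weakened). -/
theorem exists_join_of_sat (I : LocalMap 4 n m) (hI : I.IsPure xorAndPred) (hT : Typed I) (hS : SimpleOverlap I) {r : ℕ}
    (hB : BoundaryExpanding r I) (y : Fin m → Bool) {J₀ : Finset (Fin m)} (hr : J₀.card ≤ r)
    {C₁ C₂ : Finset (Fin n)} {G₁ G₂ : Finset (Fin m)} {b₁ b₂ : Bool} (hG₁ : Disjoint J₀ G₁) (hG₂ : Disjoint J₀ G₂)
    (hT3 : ¬ ∃ z : Fin n → Bool, (∀ j ∈ J₀, I.eval z j = y j) ∧ gval I C₁ G₁ z = b₁ ∧ gval I C₂ G₂ z = b₂)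
    (hsat : ∃ z : Fin n → Bool, gval I C₁ G₁ z = b₁ ∧ gval I C₂ G₂ z = b₂)
    {F : Finset (Fin m)}
    (hconn : ∀ e ∈ J₀, Relation.ReflTransGen (fun x y => ∃ j ∈ F, x ∈ xpair I j ∧ y ∈ xpair I j) (I.vars e 0) (I.vars e 1)) :
    (∃ T₁ ⊆ F, ∀ w, Odd (xpdeg I T₁ w) ↔ (w ∈ C₁ ∧ w ∈ xverts I F)) ∧
    (∃ T₂ ⊆ F, ∀ w, Odd (xpdeg I T₂ w) ↔ (w ∈ C₂ ∧ w ∈ xverts I F)) := by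
  have key : ∀ U ⊆ xverts I F, (∀ j ∈ F, (I.vars j 0 ∈ U ↔ I.vars j 1 ∈ U)) →
      Even (C₁.filter fun v => v ∈ U).card ∧ Even (C₂.filter fun v => v ∈ U).card := by
    intro U hU hclF
    have hUand : ∀ (j : Fin m) (s : Fin 4), 2 ≤ s.val → I.vars j s ∉ U := fun j s hs h => not_mem_xverts_of_two_le I hT F j hs (hU h)
    exact closed_even_of_sat I hI hT hS hB y hr hG₁ hG₂ hT3 hsat hUand fun j hj => closed_of_chain I hclF (hconn j hj)
  exact ⟨exists_join I F C₁ fun U hU hcl => (key U hU hcl).1, exists_join I F C₂ fun U hU hcl => (key U hU hcl).2⟩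

/-- **Bridge data from one satisfying assignment** (`PstarChordBridgeAssemble.exists_bridgeData` with (M0) weakened; no chord-minimality is claimed). -/
theorem exists_bridgeData_of_sat (I : LocalMap 4 n m) (hI : I.IsPure xorAndPred) (hT : Typed I) (hS : SimpleOverlap I) {r : ℕ}
    (hB : BoundaryExpanding r I) (y : Fin m → Bool) {J₀ : Finset (Fin m)} (hr : J₀.card ≤ r)
    (w₁ w₂ : Finset (Fin n) × Finset (Fin m) × Bool) (hG₁ : Disjoint J₀ w₁.2.1) (hG₂ : Disjoint J₀ w₂.2.1)
    (hT3 : ¬ ∃ z : Fin n → Bool, (∀ j ∈ J₀, I.eval z j = y j) ∧ gval I w₁.1 w₁.2.1 z = w₁.2.2 ∧ gval I w₂.1 w₂.2.1 z = w₂.2.2)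
    (hsat : ∃ z : Fin n → Bool, gval I w₁.1 w₁.2.1 z = w₁.2.2 ∧ gval I w₂.1 w₂.2.1 z = w₂.2.2)
    {F : Finset (Fin m)} (hF : F ⊆ J₀) (hP : Peelable I F) (hmax : ∀ F', F ⊆ F' → F' ⊆ J₀ → Peelable I F' → F' = F)
    (hchord : ∀ e ∈ J₀ \ F, IsChord I J₀ e)
    (hcross : ∀ g ∈ w₁.2.1 ∪ w₂.2.1, ¬ (I.vars g 2 ∈ privs I (J₀ \ F) ∧ I.vars g 3 ∈ privs I (J₀ \ F))) :
    ∃ B : BridgeData n m, B.y = y ∧ B.J₀ = J₀ ∧ B.N = J₀ \ F ∧ HasConstraints B w₁ w₂ ∧ B.WF I ∧ Lift I B ∧ B.T₂ ⊆ F := by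
  classical
  have hFN : J₀ \ (J₀ \ F) = F := Finset.sdiff_sdiff_eq_self hF
  have hfund : ∀ e, ∃ D : Finset (Fin m), e ∈ J₀ \ F → D ⊆ F ∧ e ∉ D ∧ ∀ w, Even (xpdeg I (insert e D) w) := by
    intro e
    by_cases he : e ∈ J₀ \ F
    · obtain ⟨D, hD, heD, hev⟩ := exists_fundamental_of_maximal I hI hF hP hmax he
      exact ⟨D, fun _ => ⟨hD, heD, hev⟩⟩
    · exact ⟨∅, fun h => absurd h he⟩
  choose D hD using hfund
  have hconn : ∀ e ∈ J₀, Relation.ReflTransGen (fun x y => ∃ j ∈ F, x ∈ xpair I j ∧ y ∈ xpair I j) (I.vars e 0) (I.vars e 1) := by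
    intro e he
    by_cases heF : e ∈ F
    · exact Relation.ReflTransGen.single ⟨e, heF, (mem_xpair I).2 (Or.inl rfl), (mem_xpair I).2 (Or.inr rfl)⟩
    · have he' : e ∈ J₀ \ F := mem_sdiff.2 ⟨he, heF⟩
      obtain ⟨hDF, heD, hev⟩ := hD e he'
      exact reflTransGen_mono I hDF (ends_connected_of_even I hI heD hev)
  obtain ⟨⟨T₁, hT₁F, hT₁⟩, ⟨T₂, hT₂F, hT₂⟩⟩ := exists_join_of_sat I hI hT hS hB y hr hG₁ hG₂ hT3 hsat (F := F) hconn
  let B : BridgeData n m :=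
    { y := y, J₀ := J₀, N := J₀ \ F, D := D, C₁ := w₁.1, G₁ := w₁.2.1, b₁ := w₁.2.2, T₁ := T₁,
      C₂ := w₂.1, G₂ := w₂.2.1, b₂ := w₂.2.2, T₂ := T₂ }
  have hW : B.WF I :=
    { hN := sdiff_subset
      hchord := hchord
      hD := fun e he => by show D e ⊆ J₀ \ (J₀ \ F); rw [hFN]; exact (hD e he).1
      hDeven := fun e he => (hD e he).2.2
      hT₁ := by show T₁ ⊆ J₀ \ (J₀ \ F); rw [hFN]; exact hT₁F
      hT₂ := by show T₂ ⊆ J₀ \ (J₀ \ F); rw [hFN]; exact hT₂F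
      hjoin₁ := fun w => by show Odd (xpdeg I T₁ w) ↔ w ∈ w₁.1 ∧ w ∈ xverts I (J₀ \ (J₀ \ F)); rw [hFN]; exact hT₁ w
      hjoin₂ := fun w => by show Odd (xpdeg I T₂ w) ↔ w ∈ w₂.1 ∧ w ∈ xverts I (J₀ \ (J₀ \ F)); rw [hFN]; exact hT₂ w
      hcross₁ := fun g hg => hcross g (mem_union_left _ hg)
      hcross₂ := fun g hg => hcross g (mem_union_right _ hg) }
  have hL : Lift I B := lift_of_wf_peelable I hI hT B (by show Peelable I (J₀ \ (J₀ \ F)); rw [hFN]; exact hP)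
  exact ⟨B, rfl, rfl, rfl, ⟨rfl, rfl, rfl, rfl, rfl, rfl⟩, hW, hL, hT₂F⟩

/-! ## The union configuration -/

/-- **Bridge data for a union-terminal core.**  Union-terminal `(J₀; A₀, A₁, w₂)` on a pure typed `(r,3/2)`-expanding instance with simple overlaps, a maximal peelable
`F ⊆ J₀` whose complement consists of chords, hun.  Then for `R` := a reader released by some output (there is one: `J₀ ≠ ∅` and the cover) and `R′` the other
reader, the pair `(R, w₂)` packages as well-formed liftable bridge data `B` with `B.N = J₀ ∖ F`, and the hypotheses of `PstarUnionRankSixEmpty.caseA_empty_of_kernel_trivial`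
hold: `R′` agrees with `R` on the XOR vertices, hun in bridge form, (T3) for both pairs, and the cover (M0′). -/
theorem exists_union_bridgeData (I : LocalMap 4 n m) (hI : I.IsPure xorAndPred) (hT : Typed I) (hS : SimpleOverlap I) {r : ℕ}
    (hB : BoundaryExpanding r I) {y : Fin m → Bool} {J₀ : Finset (Fin m)} {A₀ A₁ w₂ : Finset (Fin n) × Finset (Fin m) × Bool}
    (hU : UnionTerminal I r y J₀ A₀ A₁ w₂) {F : Finset (Fin m)} (hF : F ⊆ J₀) (hP : Peelable I F)
    (hmax : ∀ F', F ⊆ F' → F' ⊆ J₀ → Peelable I F' → F' = F) (hchord : ∀ e ∈ J₀ \ F, IsChord I J₀ e)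
    (hun : ∀ g ∈ A₀.2.1 ∪ w₂.2.1, ∀ v ∈ privs I (J₀ \ F), I.vars g 2 ≠ v ∧ I.vars g 3 ≠ v) :
    ∃ (B : BridgeData n m) (R R' : Finset (Fin n) × Finset (Fin m) × Bool),
      ((R = A₀ ∧ R' = A₁) ∨ (R = A₁ ∧ R' = A₀)) ∧
      B.y = y ∧ B.J₀ = J₀ ∧ B.N = J₀ \ F ∧ HasConstraints B R w₂ ∧ B.WF I ∧ Lift I B ∧ B.T₂ ⊆ F ∧
      Disjoint B.G₁ B.J₀ ∧ Disjoint B.G₂ B.J₀ ∧ B.J₀.Nonempty ∧ R'.2.1 = B.G₁ ∧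
      (∀ v ∈ B.C₁ ∆ R'.1, v ∉ xverts I (B.J₀ \ B.N)) ∧
      (∀ v ∈ privs I B.N, (∀ g ∈ B.G₁, I.vars g 2 ≠ v ∧ I.vars g 3 ≠ v) ∧ ∀ g ∈ B.G₂, I.vars g 2 ≠ v ∧ I.vars g 3 ≠ v) ∧
      (¬ ∃ z, Solution I B B.J₀ z) ∧ (¬ ∃ z, Solution I { B with C₁ := R'.1, b₁ := R'.2.2 } B.J₀ z) ∧
      (∀ f ∈ B.J₀, (∃ z, Solution I B (B.J₀.erase f) z) ∨ (∃ z, Solution I { B with C₁ := R'.1, b₁ := R'.2.2 } (B.J₀.erase f) z)) := by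
  classical
  obtain ⟨hne, -, hJr, hG, hd₀, hd₂, -, hxor, hn₀, hn₁, hcov⟩ := hU
  have hFN : J₀ \ (J₀ \ F) = F := Finset.sdiff_sdiff_eq_self hF
  -- generic packaging of a pair `(R, w₂)` released somewhere, with second reader `R'`
  have main : ∀ R R' : Finset (Fin n) × Finset (Fin m) × Bool, R.2.1 = A₀.2.1 → R'.2.1 = A₀.2.1 →
      (∀ v ∈ R.1 ∆ R'.1, ∀ j ∈ J₀, I.vars j 0 ≠ v ∧ I.vars j 1 ≠ v) →
      ¬ SatPair I y J₀ R w₂ → ¬ SatPair I y J₀ R' w₂ →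
      (∀ f ∈ J₀, SatPair I y (J₀.erase f) R w₂ ∨ SatPair I y (J₀.erase f) R' w₂) →
      (∃ z : Fin n → Bool, gval I R.1 R.2.1 z = R.2.2 ∧ gval I w₂.1 w₂.2.1 z = w₂.2.2) →
      ∃ B : BridgeData n m,
        B.y = y ∧ B.J₀ = J₀ ∧ B.N = J₀ \ F ∧ HasConstraints B R w₂ ∧ B.WF I ∧ Lift I B ∧ B.T₂ ⊆ F ∧
        Disjoint B.G₁ B.J₀ ∧ Disjoint B.G₂ B.J₀ ∧ B.J₀.Nonempty ∧ R'.2.1 = B.G₁ ∧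
        (∀ v ∈ B.C₁ ∆ R'.1, v ∉ xverts I (B.J₀ \ B.N)) ∧
        (∀ v ∈ privs I B.N, (∀ g ∈ B.G₁, I.vars g 2 ≠ v ∧ I.vars g 3 ≠ v) ∧ ∀ g ∈ B.G₂, I.vars g 2 ≠ v ∧ I.vars g 3 ≠ v) ∧
        (¬ ∃ z, Solution I B B.J₀ z) ∧ (¬ ∃ z, Solution I { B with C₁ := R'.1, b₁ := R'.2.2 } B.J₀ z) ∧
        (∀ f ∈ B.J₀, (∃ z, Solution I B (B.J₀.erase f) z) ∨ (∃ z, Solution I { B with C₁ := R'.1, b₁ := R'.2.2 } (B.J₀.erase f) z)) := by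
    intro R R' hRG hR'G hx hT3 hT3' hcv hsat
    have hd₁ : Disjoint J₀ R.2.1 := by rw [hRG]; exact hd₀
    have hunR : ∀ g ∈ R.2.1 ∪ w₂.2.1, ∀ v ∈ privs I (J₀ \ F), I.vars g 2 ≠ v ∧ I.vars g 3 ≠ v := by rw [hRG]; exact hun
    have hcross : ∀ g ∈ R.2.1 ∪ w₂.2.1, ¬ (I.vars g 2 ∈ privs I (J₀ \ F) ∧ I.vars g 3 ∈ privs I (J₀ \ F)) :=
      fun g hg h => (hunR g hg _ h.1).1 rfl
    obtain ⟨B, hy, hJ, hN, ⟨hC1, hG1, hb1, hC2, hG2, hb2⟩, hW, hL, hT₂F⟩ :=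
      exists_bridgeData_of_sat I hI hT hS hB y hJr.le R w₂ hd₁ hd₂ hT3 hsat hF hP hmax hchord hcross
    subst hy hJ
    refine ⟨B, rfl, rfl, hN, ⟨hC1, hG1, hb1, hC2, hG2, hb2⟩, hW, hL, hT₂F, ?_, ?_, hne, ?_, ?_, ?_, ?_, ?_, ?_⟩
    · rw [hG1]; exact hd₁.symm
    · rw [hG2]; exact hd₂.symm
    · rw [hG1, hR'G, hRG]
    · intro v hv hvx
      rw [hC1] at hv
      rw [hN, hFN] at hvx
      obtain ⟨j, hj, hvj⟩ := mem_biUnion.1 hvx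
      rcases (mem_xpair I).1 hvj with h | h
      · exact (hx v hv j (hF hj)).1 h.symm
      · exact (hx v hv j (hF hj)).2 h.symm
    · intro v hv
      rw [hN] at hv
      rw [hG1, hG2]
      exact ⟨fun g hg => hunR g (mem_union_left _ hg) v hv, fun g hg => hunR g (mem_union_right _ hg) v hv⟩
    · rintro ⟨z, hzJ, hz1, hz2⟩
      rw [hC1, hG1, hb1] at hz1
      rw [hC2, hG2, hb2] at hz2
      exact hT3 ⟨z, hzJ, hz1, hz2⟩
    · rintro ⟨z, hzJ, hz1, hz2⟩
      have hz1' : gval I R'.1 B.G₁ z = R'.2.2 := hz1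
      have hz2' : gval I B.C₂ B.G₂ z = B.b₂ := hz2
      rw [hG1, hRG, ← hR'G] at hz1'
      rw [hC2, hG2, hb2] at hz2'
      exact hT3' ⟨z, hzJ, hz1', hz2'⟩
    · intro f hf
      rcases hcv f hf with ⟨z, hzJ, hz1, hz2⟩ | ⟨z, hzJ, hz1, hz2⟩
      · left
        refine ⟨z, hzJ, ?_, ?_⟩
        · rw [hC1, hG1, hb1]; exact hz1
        · rw [hC2, hG2, hb2]; exact hz2
      · right
        refine ⟨z, hzJ, ?_, ?_⟩
        · show gval I R'.1 B.G₁ z = R'.2.2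
          rw [hG1, hRG, ← hR'G]; exact hz1
        · show gval I B.C₂ B.G₂ z = B.b₂
          rw [hC2, hG2, hb2]; exact hz2
  -- a reader released somewhere
  obtain ⟨f, hf⟩ := hne
  rcases hcov f hf with ⟨z, -, hz1, hz2⟩ | ⟨z, -, hz1, hz2⟩
  · obtain ⟨B, h⟩ := main A₀ A₁ rfl hG hxor hn₀ hn₁ hcov ⟨z, hz1, hz2⟩
    exact ⟨B, A₀, A₁, Or.inl ⟨rfl, rfl⟩, h⟩
  · have hxor' : ∀ v ∈ A₁.1 ∆ A₀.1, ∀ j ∈ J₀, I.vars j 0 ≠ v ∧ I.vars j 1 ≠ v := by rw [symmDiff_comm]; exact hxor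
    obtain ⟨B, h⟩ := main A₁ A₀ hG rfl hxor' hn₁ hn₀ (fun f hf => (hcov f hf).symm) ⟨z, hz1, hz2⟩
    exact ⟨B, A₁, A₀, Or.inr ⟨rfl, rfl⟩, h⟩

/-- **Node (α) at the instance level.**  The hypotheses of `PstarUnionAtoms.CaseAFive` (union-terminal core, admissible `F`, hun, `w₂` chord-blind) are contradictory as
soon as, for every join `T₂ ⊆ F` of the XOR reads of `w₂`, the function `q = free₂ + b₂` built with it has a zero and trivial kernel. -/
theorem caseA_false_of_kernel_trivial (I : LocalMap 4 n m) (hI : I.IsPure xorAndPred) (hT : Typed I) (hS : SimpleOverlap I) {r : ℕ}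
    (hB : BoundaryExpanding r I) {y : Fin m → Bool} {J₀ : Finset (Fin m)} {A₀ A₁ w₂ : Finset (Fin n) × Finset (Fin m) × Bool}
    (hU : UnionTerminal I r y J₀ A₀ A₁ w₂) {F : Finset (Fin m)} (hF : F ⊆ J₀) (hP : Peelable I F)
    (hmax : ∀ F', F ⊆ F' → F' ⊆ J₀ → Peelable I F' → F' = F) (hchord : ∀ e ∈ J₀ \ F, IsChord I J₀ e)
    (hun : ∀ g ∈ A₀.2.1 ∪ w₂.2.1, ∀ v ∈ privs I (J₀ \ F), I.vars g 2 ≠ v ∧ I.vars g 3 ≠ v)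
    (hblind : ∀ v ∈ privs I (J₀ \ F), v ∉ w₂.1)
    (hK : ∀ T₂ ⊆ F, (∀ w, Odd (xpdeg I T₂ w) ↔ w ∈ w₂.1 ∧ w ∈ xverts I F) →
      (∃ a, free I y F (J₀ \ F) T₂ w₂.1 w₂.2.1 a = bit w₂.2.2) ∧
      ∀ g : (Fin n → ZMod 2) → ZMod 2, IsQuadFn g → (∀ x, free I y F (J₀ \ F) T₂ w₂.1 w₂.2.1 x + bit w₂.2.2 = 0 → g x = 0) →
        (∀ x, g x = 0) ∨ (∀ x, g x = free I y F (J₀ \ F) T₂ w₂.1 w₂.2.1 x + bit w₂.2.2)) : False := by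
  classical
  obtain ⟨B, R, R', -, hy, hJ, hN, ⟨-, -, -, hC2, hG2, hb2⟩, hW, hL, hT₂F, hG₁, hG₂, hne, hR'G, hC, hunB, hT3, hT3', hM0⟩ :=
    exists_union_bridgeData I hI hT hS hB hU hF hP hmax hchord hun
  subst hy hJ
  have hFN : B.J₀ \ B.N = F := by rw [hN]; exact Finset.sdiff_sdiff_eq_self hF
  have hjoin : ∀ w, Odd (xpdeg I B.T₂ w) ↔ w ∈ w₂.1 ∧ w ∈ xverts I F := fun w => by rw [← hC2, ← hFN]; exact hW.hjoin₂ w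
  obtain ⟨hZ, hK'⟩ := hK B.T₂ hT₂F hjoin
  rw [← hN, ← hFN, ← hC2, ← hG2, ← hb2] at hZ hK'
  have hblindB : ∀ v ∈ privs I B.N, v ∉ B.C₂ := by rw [hN, hC2]; exact hblind
  exact caseA_empty_of_kernel_trivial I hI hT hS hW hL hG₁ hG₂ hne hC hunB hblindB hT3 hT3' hM0 hZ hK'

end Summit.PneNP.PneNP.Theorems.PstarUnionBridgeData
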